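/-
Copyright: b2b-lace packet (tail-bound analyst, gen 2). Rule PCS (KSUP.md §9): the K-cell sup
reduction under PARITY-CLASS monotonicity only (no coordinatewise x-monotonicity of I_{n,2j}).
-/
import Literature.Probability.FitznerVanDerHofstad2017.SrwIntegralB3Transport

/-!
# Parity-class domination for `W_{n,2j}` and `K_{n,l}` (rule PCS)

`ParityMonotone f`: `f z ≤ f z'` whenever `|z'_μ| ≤ |z_μ|` and `z_μ ≡ z'_μ (mod 2)` for every `μ`.
For `f = I_{n,2j}` this follows from the reflection principle for simple random walk (KSUP.md
§9.1a) — NOT from [HS92b] Lemma B.3, and it does not assert the parity-changing step of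
[FitznerVanDerHofstad2016NoBLE] Lemma 5.1.  Here it is a HYPOTHESIS.

Representative map `x ↦ x*`: `x*_μ = 0, ±1, ±2` according as `x_μ = 0`, odd, even `≠ 0` (sign
kept).  TERMWISE PARITY DOMINATION: for every signed permutation `σ` and every `μ`,
`(x* - σx*)_μ ≡ (x - σx)_μ (mod 2)` and `|(x* - σx*)_μ| ≤ |(x - σx)_μ|`; for `x = a e_i` with `a` odd,
`|a| ≥ 3`, the same holds with `x* = 3·sgn(a) e_i`.  Consequences: `W_{n,j}(x) ≤ W_{n,j}(x*)` and
`K_{n,m+j}(x) ≤ √I_{n,2m}(0) · √W_{n,j}(x*)`.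
-/

namespace Literature.Probability.FitznerVanDerHofstad2017

open MeasureTheory Finset Real

variable {d : ℕ}

/-- Parity-class monotonicity: non-increase under parity-preserving domination of absolute values.
(b2b-lace KSUP.md §9.1.) [folklore] -/
def ParityMonotone (f : (Fin d → ℤ) → ℝ) : Prop :=
  ∀ z z' : Fin d → ℤ, (∀ μ, |z' μ| ≤ |z μ| ∧ (z μ - z' μ) % 2 = 0) → f z ≤ f z'

/-- Coordinatewise monotonicity implies parity-class monotonicity. [folklore] -/
theorem parityMonotone_of_absMonotone {f : (Fin d → ℤ) → ℝ} (hf : AbsMonotone f) :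
    ParityMonotone f :=
  fun z z' h => hf z z' fun μ => (h μ).1

/-- Parity representative of one entry: `0 ↦ 0`, odd `a ↦ sgn a`, even `a ≠ 0 ↦ 2 sgn a`. [folklore] -/
def prep (a : ℤ) : ℤ := if a = 0 then 0 else if a % 2 = 0 then 2 * Int.sign a else Int.sign a

/-- Case description of `prep`. [folklore] -/
theorem prep_spec (a : ℤ) :
    (a = 0 ∧ prep a = 0) ∨ (0 < a ∧ a % 2 = 1 ∧ prep a = 1) ∨ (a < 0 ∧ a % 2 = 1 ∧ prep a = -1) ∨
    (0 < a ∧ a % 2 = 0 ∧ prep a = 2) ∨ (a < 0 ∧ a % 2 = 0 ∧ prep a = -2) := by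
  unfold prep
  rcases lt_trichotomy a 0 with ha | rfl | ha
  · have hs : Int.sign a = -1 := Int.sign_eq_neg_one_of_neg ha
    rcases Int.emod_two_eq_zero_or_one a with h2 | h2
    · right; right; right; right; exact ⟨ha, h2, by simp [ha.ne, h2, hs]⟩
    · right; right; left; exact ⟨ha, h2, by simp [ha.ne, h2, hs]⟩
  · left; simp
  · have hs : Int.sign a = 1 := Int.sign_eq_one_of_pos ha
    rcases Int.emod_two_eq_zero_or_one a with h2 | h2
    · right; right; right; left; exact ⟨ha, h2, by simp [ha.ne', h2, hs]⟩
    · right; left; exact ⟨ha, h2, by simp [ha.ne', h2, hs]⟩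

/-- The arithmetic core of termwise parity domination: for `s = ±1`,
`|prep a - s·prep b| ≤ |a - s·b|` and the two differences have the same parity. [folklore] -/
theorem prep_core (s a b : ℤ) (hs : s = 1 ∨ s = -1) :
    |prep a - s * prep b| ≤ |a - s * b| ∧ ((a - s * b) - (prep a - s * prep b)) % 2 = 0 := by
  rcases hs with rfl | rfl <;>
  rcases prep_spec a with ⟨ha, hpa⟩ | ⟨ha, ha2, hpa⟩ | ⟨ha, ha2, hpa⟩ | ⟨ha, ha2, hpa⟩ | ⟨ha, ha2, hpa⟩ <;>
  rcases prep_spec b with ⟨hb, hpb⟩ | ⟨hb, hb2, hpb⟩ | ⟨hb, hb2, hpb⟩ | ⟨hb, hb2, hpb⟩ | ⟨hb, hb2, hpb⟩ <;>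
  (rw [hpa, hpb]; simp only [Int.abs_eq_natAbs]; constructor <;> omega)

/-- The parity representative `x*` of a lattice vector. [folklore] -/
def parityRep (x : Fin d → ℤ) : Fin d → ℤ := fun μ => prep (x μ)

/-- TERMWISE PARITY DOMINATION: `|(x* - σx*)_μ| ≤ |(x - σx)_μ|` with equal parity, for every signed
permutation `σ` and every `μ`. (b2b-lace KSUP.md §9.2.) [folklore] -/
theorem parityRep_sub_sgnPerm (x : Fin d → ℤ) (ν : Equiv.Perm (Fin d)) (δ : Fin d → ℤˣ)
    (μ : Fin d) :
    |(parityRep x - sgnPerm ν δ (parityRep x)) μ| ≤ |(x - sgnPerm ν δ x) μ| ∧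
      ((x - sgnPerm ν δ x) μ - (parityRep x - sgnPerm ν δ (parityRep x)) μ) % 2 = 0 := by
  simp only [Pi.sub_apply, sgnPerm_apply, parityRep]
  have hs : ((δ μ : ℤˣ) : ℤ) = 1 ∨ ((δ μ : ℤˣ) : ℤ) = -1 := by
    rcases Int.units_eq_one_or (δ μ) with h | h <;> simp [h]
  exact prep_core _ _ _ hs

/-- TERMWISE PARITY DOMINATION (axis): for `a` odd with `|a| ≥ 3` and `x = a e_i`, the vector
`3·sgn(a)·e_i` satisfies `|(3 sgn a · e_i - σ …)_μ| ≤ |(a e_i - σ a e_i)_μ|` with equal parity.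
(b2b-lace KSUP.md §9.2.) [folklore] -/
theorem axis_three_sub_sgnPerm (i : Fin d) (a : ℤ) (ha : 3 ≤ |a|) (hodd : a % 2 = 1)
    (ν : Equiv.Perm (Fin d)) (δ : Fin d → ℤˣ) (μ : Fin d) :
    |(axisVec i (3 * Int.sign a) - sgnPerm ν δ (axisVec i (3 * Int.sign a))) μ| ≤
        |(axisVec i a - sgnPerm ν δ (axisVec i a)) μ| ∧
      ((axisVec i a - sgnPerm ν δ (axisVec i a)) μ -
        (axisVec i (3 * Int.sign a) - sgnPerm ν δ (axisVec i (3 * Int.sign a))) μ) % 2 = 0 := by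
  rw [axisVec_sub_sgnPerm i (3 * Int.sign a), axisVec_sub_sgnPerm i a]
  -- the common factor `c = (e_i - σ e_i)_μ ∈ {0, ±1, ±2}`
  set c := (axisVec i 1 - sgnPerm ν δ (axisVec i 1)) μ with hc
  have hcv : c = 0 ∨ c = 1 ∨ c = -1 ∨ c = 2 ∨ c = -2 := by
    have hs : ((δ μ : ℤˣ) : ℤ) = 1 ∨ ((δ μ : ℤˣ) : ℤ) = -1 := by
      rcases Int.units_eq_one_or (δ μ) with h | h <;> simp [h]
    simp only [hc, Pi.sub_apply, sgnPerm_apply, axisVec]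
    rcases hs with h | h <;> rw [h] <;> split_ifs <;> norm_num
  have hsgn : (0 < a ∧ Int.sign a = 1) ∨ (a < 0 ∧ Int.sign a = -1) := by
    rcases lt_trichotomy a 0 with h | rfl | h
    · exact Or.inr ⟨h, Int.sign_eq_neg_one_of_neg h⟩
    · simp at hodd
    · exact Or.inl ⟨h, Int.sign_eq_one_of_pos h⟩
  rw [Int.abs_eq_natAbs] at ha
  rcases hsgn with ⟨hpos, hs⟩ | ⟨hneg, hs⟩ <;> rw [hs] <;>
  rcases hcv with h | h | h | h | h <;> (rw [h]; simp only [Int.abs_eq_natAbs]; constructor <;> omega)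

/-- Orbit sums under parity domination: if `f` is parity-monotone and `y - σy` is parity-dominated by
`x - σx` termwise for every `σ`, then `Σ_σ f(x - σx) ≤ Σ_σ f(y - σy)`. [folklore] -/
theorem sum_sgnPerm_le_of_parityDominated (f : (Fin d → ℤ) → ℝ) (hmono : ParityMonotone f)
    (x y : Fin d → ℤ)
    (hdom : ∀ (ν : Equiv.Perm (Fin d)) (δ : Fin d → ℤˣ) (μ : Fin d),
      |(y - sgnPerm ν δ y) μ| ≤ |(x - sgnPerm ν δ x) μ| ∧
        ((x - sgnPerm ν δ x) μ - (y - sgnPerm ν δ y) μ) % 2 = 0) :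
    ∑ ν : Equiv.Perm (Fin d), ∑ δ : Fin d → ℤˣ, f (x - sgnPerm ν δ x) ≤
      ∑ ν : Equiv.Perm (Fin d), ∑ δ : Fin d → ℤˣ, f (y - sgnPerm ν δ y) := by
  apply Finset.sum_le_sum; intro ν _
  apply Finset.sum_le_sum; intro δ _
  exact hmono _ _ (hdom ν δ)

/-- `orbitAvg f x ≤ orbitAvg f x*` under parity monotonicity. (b2b-lace KSUP.md §9.2.) [folklore] -/
theorem orbitAvg_le_parityRep (f : (Fin d → ℤ) → ℝ) (hmono : ParityMonotone f)
    (x : Fin d → ℤ) : orbitAvg f x ≤ orbitAvg f (parityRep x) := by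
  unfold orbitAvg
  apply div_le_div_of_nonneg_right _ (by positivity)
  exact sum_sgnPerm_le_of_parityDominated f hmono x (parityRep x)
    (fun ν δ μ => parityRep_sub_sgnPerm x ν δ μ)

/-- `orbitAvg f (a e_i) ≤ orbitAvg f (3 sgn(a) e_i)` for `a` odd, `|a| ≥ 3`. [folklore] -/
theorem orbitAvg_le_axis_three (f : (Fin d → ℤ) → ℝ) (hmono : ParityMonotone f)
    (i : Fin d) (a : ℤ) (ha : 3 ≤ |a|) (hodd : a % 2 = 1) :
    orbitAvg f (axisVec i a) ≤ orbitAvg f (axisVec i (3 * Int.sign a)) := by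
  unfold orbitAvg
  apply div_le_div_of_nonneg_right _ (by positivity)
  exact sum_sgnPerm_le_of_parityDominated f hmono _ _
    (fun ν δ μ => axis_three_sub_sgnPerm i a ha hodd ν δ μ)

/-- **PCS, W-level**: `W_{n,j}(x) ≤ W_{n,j}(x*)` under `ParityMonotone (I_{n,2j})`.
(b2b-lace KSUP.md §9.2.) [folklore] -/
theorem srwW_le_srwW_parityRep {n : ℕ} (hd : 2 * n + 1 ≤ d) (j : ℕ)
    (hmono : ParityMonotone (srwI d n (2 * j))) (x : Fin d → ℤ) :
    srwW d n j x ≤ srwW d n j (parityRep x) := by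
  rw [srwW_eq_orbitAvg hd, srwW_eq_orbitAvg hd]
  exact orbitAvg_le_parityRep _ hmono x

/-- **PCS, W-level, axis**: `W_{n,j}(a e_i) ≤ W_{n,j}(3 sgn(a) e_i)` for `a` odd, `|a| ≥ 3`. [folklore] -/
theorem srwW_le_srwW_axis_three {n : ℕ} (hd : 2 * n + 1 ≤ d) (j : ℕ)
    (hmono : ParityMonotone (srwI d n (2 * j))) (i : Fin d) (a : ℤ) (ha : 3 ≤ |a|)
    (hodd : a % 2 = 1) :
    srwW d n j (axisVec i a) ≤ srwW d n j (axisVec i (3 * Int.sign a)) := by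
  rw [srwW_eq_orbitAvg hd, srwW_eq_orbitAvg hd]
  exact orbitAvg_le_axis_three _ hmono i a ha hodd

/-- **PCS, K-level**: `K_{n,m+j}(x) ≤ √I_{n,2m}(0) · √W_{n,j}(x*)` under `ParityMonotone (I_{n,2j})`
— the sup over the infinite parity class of `x` is carried by the single representative `x*`.
(b2b-lace KSUP.md §9.2, rule PCS-K.) [folklore] -/
theorem srwK_le_sqrt_srwW_parityRep {n : ℕ} (hd : 2 * n + 1 ≤ d) (m j : ℕ)
    (hmono : ParityMonotone (srwI d n (2 * j))) (x : Fin d → ℤ) :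
    srwK d n (m + j) x ≤
      Real.sqrt (srwI d n (2 * m) 0) * Real.sqrt (srwW d n j (parityRep x)) :=
  srwK_le_sqrt_of_srwW_le hd m j x (srwW_le_srwW_parityRep hd j hmono x)

/-- **PCS, K-level, axis**: `K_{n,m+j}(a e_i) ≤ √I_{n,2m}(0) · √W_{n,j}(3 sgn(a) e_i)` for `a` odd,
`|a| ≥ 3`. [folklore] -/
theorem srwK_le_sqrt_srwW_axis_three {n : ℕ} (hd : 2 * n + 1 ≤ d) (m j : ℕ)
    (hmono : ParityMonotone (srwI d n (2 * j))) (i : Fin d) (a : ℤ) (ha : 3 ≤ |a|)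
    (hodd : a % 2 = 1) :
    srwK d n (m + j) (axisVec i a) ≤
      Real.sqrt (srwI d n (2 * m) 0) * Real.sqrt (srwW d n j (axisVec i (3 * Int.sign a))) :=
  srwK_le_sqrt_of_srwW_le hd m j _ (srwW_le_srwW_axis_three hd j hmono i a ha hodd)

/-- For `j = 0` the hypothesis is discharged by the PRINTED [HS92b] Lemma B.3 (`m = 0`) through
`absMonotone_srwI_of_B3`: parity monotonicity of `I_{n,0}`. [cite: FitznerVanDerHofstad2016NoBLE, Lemma 5.1 p. 1093] -/
theorem parityMonotone_srwI_zero_of_B3 (n : ℕ)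
    (hB3 : ∀ (x : Fin d → ℤ) (ι : Fin d), 0 ≤ x ι →
      srwI d n 0 (x + axisVec ι 1) ≤ srwI d n 0 x) :
    ParityMonotone (srwI d n 0) :=
  parityMonotone_of_absMonotone (absMonotone_srwI_of_B3 n 0 hB3)

end Literature.Probability.FitznerVanDerHofstad2017
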